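import Summits.KontsevichZagierPeriods.KontsevichZagierPeriods.Theorems.RootDecompZetaThreeFrontierRungFourPreludeP01

/-! # `RootDecompZetaThreeFrontierRungFourPreludeP02` — part 2/14 of the mechanical ≤400-line split of `pre_src.lean` (sha256 ba362a5194d75c20…)
Source: decomp-kz lens-1 g12/g13 rung-4 prelude = Prelude_v3.lean @ba362a51 (Basis22_v1 sections RotFour/Shuffle/ProdFour/GenFb/WordMoves/RungFour/Basis22 + FacetGeneric_v2 §1–§23; critic CLEARED g6 row 330 / g6-20 l.1368); --supports stmt-KontsevichZagierPeriods-27141.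
Split by census-1 g10 `gen/splitlean.py`: scopes re-opened with their `open`/`variable`/`set_option` context; mathematics and declaration order unchanged. -/

set_option linter.dupNamespace false
noncomputable section
namespace Summit.KontsevichZagierPeriods.KontsevichZagierPeriods.Cruxes.GZNormalFormWThree.GZLadder.RotFour
open Set MeasureTheory MvPolynomial
open Literature.NumberTheory.Transcendental
open Literature.ModelTheory.ExponentialFields

/-- Auxiliary step `rtBinv_mem`: rt Binv mem. [bookkeeping] -/
theorem rtBinv_mem {u : Fin 4 → ℝ} (hu : u ∈ KZ.openOrderedSimplex 4) : rtBinv u ∈ rtDom := by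
  obtain ⟨h3, h32, h21, h10, h0⟩ := (mem_simplex_four_iff u).1 hu
  have g0 : 0 < 1 - u 0 := by linarith
  have g1 : 0 < 1 - u 1 := by linarith
  have g2 : 0 < 1 - u 2 := by linarith
  have g3 : 0 < 1 - u 3 := by linarith
  rw [mem_rtDom_iff, rtBinv_zero, rtBinv_one, rtBinv_two, rtBinv_three]
  refine ⟨?_, ?_, ?_, by positivity, by positivity, ?_⟩
  · exact div_lt_div_of_pos_left g0 g1 (by linarith)
  · rw [div_lt_one g1]; linarith
  · exact div_lt_div_of_pos_left g0 g2 (by linarith)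
  · have : (1 - u 0) / (1 - u 1) * ((1 - u 0) / (1 - u 2)) *
        ((1 - u 1) * (1 - u 2) * (1 - u 3) / (1 - u 0) ^ 2) = 1 - u 3 := by
      field_simp
    rw [this]
    linarith

/-- Auxiliary step `rtB_rtBinv`: rt B rt Binv. [bookkeeping] -/
theorem rtB_rtBinv {u : Fin 4 → ℝ} (hu : u ∈ KZ.openOrderedSimplex 4) : rtB (rtBinv u) = u := by
  obtain ⟨h3, h32, h21, h10, h0⟩ := (mem_simplex_four_iff u).1 hu
  have g0 : (1 : ℝ) - u 0 ≠ 0 := by linarith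
  have g1 : (1 : ℝ) - u 1 ≠ 0 := by linarith
  have g2 : (1 : ℝ) - u 2 ≠ 0 := by linarith
  have g3 : (1 : ℝ) - u 3 ≠ 0 := by linarith
  funext i
  fin_cases i
  · simp [rtB, rtBinv]; field_simp; ring
  · simp [rtB, rtBinv]; field_simp; ring
  · simp [rtB, rtBinv]; field_simp; ring
  · simp [rtB, rtBinv]; field_simp; ring

/-- Auxiliary step `rtBinv_rtB`: rt Binv rt B. [bookkeeping] -/
theorem rtBinv_rtB {p : Fin 4 → ℝ} (hp : p ∈ rtDom) : rtBinv (rtB p) = p := by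
  obtain ⟨h10, h0, h21, h2, h3, hlt⟩ := hp
  obtain ⟨ha, hb, hc, hd, ha', hb', hc', hd'⟩ := rtDom_facts ⟨h10, h0, h21, h2, h3, hlt⟩
  have q1 : (1 : ℝ) - (1 - p 1 * p 2 * p 3) ≠ 0 := by
    have : 0 < p 1 * p 2 * p 3 := by positivity
    linarith
  have q2 : (1 : ℝ) - (1 - p 0 * p 2 * p 3) ≠ 0 := by
    have : 0 < p 0 * p 2 * p 3 := by positivity
    linarith
  have q3 : (1 : ℝ) - (1 - p 0 * p 1 * p 3) ≠ 0 := by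
    have : 0 < p 0 * p 1 * p 3 := by positivity
    linarith
  have q0 : (1 : ℝ) - (1 - p 0 * p 1 * p 2 * p 3) ≠ 0 := by
    have : 0 < p 0 * p 1 * p 2 * p 3 := by positivity
    linarith
  funext i
  fin_cases i
  · simp [rtBinv, rtB_zero, rtB_one, rtB_two, rtB_three]; field_simp
  · simp [rtBinv, rtB_zero, rtB_one, rtB_two, rtB_three]; field_simp
  · simp [rtBinv, rtB_zero, rtB_one, rtB_two, rtB_three]; field_simp
  · simp [rtBinv, rtB_zero, rtB_one, rtB_two, rtB_three]; field_simp

/-- Auxiliary step `image_rtB`: image rt B. [bookkeeping] -/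
theorem image_rtB : rtB '' rtDom = KZ.openOrderedSimplex 4 := by
  ext u
  constructor
  · rintro ⟨p, hp, rfl⟩
    exact rtB_mem hp
  · intro hu
    exact ⟨rtBinv u, rtBinv_mem hu, rtB_rtBinv hu⟩

/-- Auxiliary step `injOn_rtB`: inj On rt B. [bookkeeping] -/
theorem injOn_rtB : InjOn rtB rtDom :=
  fun p hp q hq h => by rw [← rtBinv_rtB hp, ← rtBinv_rtB hq, h]

/-- `ρ` maps `Δ₄` into itself (it is in fact a bijection of order 7). -/
theorem rot4_mem {t : Fin 4 → ℝ} (ht : t ∈ KZ.openOrderedSimplex 4) : rot4 t ∈ KZ.openOrderedSimplex 4 := by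
  have h := rot4_rtA (rtAinv_mem ht)
  rw [rtA_rtAinv ht] at h
  rw [h]
  exact rtB_mem (rtAinv_mem ht)

/-! ## 6  Semialgebraicity of the charts -/

/-- Auxiliary step `isSemialgebraicMapOn_rtA`: is Semialgebraic Map On rt A. [bookkeeping] -/
theorem isSemialgebraicMapOn_rtA : IsSemialgebraicMapOn ℚ rtDom rtA :=
  (isSemialgebraicMapOn_aeval isSemialgebraic_rtDom
    ![X 0, X 1, X 2, (X 0 * X 1 * X 2 * X 3 : MvPolynomial (Fin 4) ℚ)]).congr
    fun p _ => by
      funext j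
      fin_cases j <;> simp [rtA_zero, rtA_one, rtA_two, rtA_three]

/-- Auxiliary step `isSemialgebraicMapOn_rtB`: is Semialgebraic Map On rt B. [bookkeeping] -/
theorem isSemialgebraicMapOn_rtB : IsSemialgebraicMapOn ℚ rtDom rtB :=
  (isSemialgebraicMapOn_aeval isSemialgebraic_rtDom
    ![C 1 - X 0 * X 1 * X 2 * X 3, C 1 - X 1 * X 2 * X 3, C 1 - X 0 * X 2 * X 3,
      (C 1 - X 0 * X 1 * X 3 : MvPolynomial (Fin 4) ℚ)]).congr
    fun p _ => by
      funext j
      fin_cases j <;> simp [rtB_zero, rtB_one, rtB_two, rtB_three]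

/-! ## 7  The pulled-back representation on `P` along chart A -/

/-- `Ψ_A^* r = [P, r.integrand ∘ Ψ_A · abc]`. -/
noncomputable def pullA (r : KZ.IntegralRep 4) (hr : r.domain = KZ.openOrderedSimplex 4) :
    KZ.IntegralRep 4 where
  domain := rtDom
  integrand := fun p => r.integrand (rtA p) * (p 0 * p 1 * p 2)
  isSemialgebraic_domain := isSemialgebraic_rtDom
  isSemialgebraicFunOn_integrand := by
    have hrs : IsSemialgebraicFunOn ℚ (KZ.openOrderedSimplex 4) r.integrand :=
      hr ▸ r.isSemialgebraicFunOn_integrand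
    have h1 : IsSemialgebraicFunOn ℚ rtDom (r.integrand ∘ rtA) :=
      IsSemialgebraicFunOn.comp_isSemialgebraicMapOn_holds hrs isSemialgebraicMapOn_rtA
        fun p hp => rtA_mem hp
    have h2 : IsSemialgebraicFunOn ℚ rtDom (fun p : Fin 4 → ℝ => p 0 * p 1 * p 2) :=
      (isSemialgebraicFunOn_aeval isSemialgebraic_rtDom (X 0 * X 1 * X 2 : MvPolynomial (Fin 4) ℚ)).congr
        fun p _ => by simp
    exact IsSemialgebraicFunOn.mul_holds h1 h2
  integrableOn := by
    have key := (integrableOn_image_iff_integrableOn_abs_det_fderiv_smul (μ := volume)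
      measurableSet_rtDom (fun x _ => (hasFDerivAt_rtA x).hasFDerivWithinAt) injOn_rtA r.integrand).1
      (by rw [image_rtA, ← hr]; exact r.integrableOn)
    refine key.congr_fun (fun p hp => ?_) measurableSet_rtDom
    simp only [abs_det_rtAL hp, smul_eq_mul]
    ring

/-- Auxiliary step `pullA_domain`: pull A domain. [bookkeeping] -/
theorem pullA_domain (r : KZ.IntegralRep 4) (hr : r.domain = KZ.openOrderedSimplex 4) :
    (pullA r hr).domain = rtDom := rfl

/-- Auxiliary step `pullA_integrand`: pull A integrand. [bookkeeping] -/
theorem pullA_integrand (r : KZ.IntegralRep 4) (hr : r.domain = KZ.openOrderedSimplex 4)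
    (p : Fin 4 → ℝ) : (pullA r hr).integrand p = r.integrand (rtA p) * (p 0 * p 1 * p 2) := rfl

/-- rule (2) along chart A: `[Ψ_A^* r] ≡ [r]`. -/
theorem pullA_rel (r : KZ.IntegralRep 4) (hr : r.domain = KZ.openOrderedSimplex 4) :
    KZ.of (pullA r hr) - KZ.of r ∈ KZ.relations := by
  have hΦsa : IsSemialgebraicMapOn ℚ (pullA r hr).domain rtA := isSemialgebraicMapOn_rtA
  have hder : ∀ x ∈ (pullA r hr).domain, HasFDerivWithinAt rtA (rtAL x) (pullA r hr).domain x :=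
    fun x _ => (hasFDerivAt_rtA x).hasFDerivWithinAt
  have hinj : InjOn rtA (pullA r hr).domain := injOn_rtA
  have hdom : r.domain = rtA '' (pullA r hr).domain := by rw [pullA_domain, image_rtA, hr]
  refine KZ.changeOfVariablesRel_subset_relations ⟨4, pullA r hr, r, rtA, rtAL, hΦsa, hder, hinj, hdom,
    fun p hp => ?_, rfl⟩
  show (pullA r hr).integrand p = r.integrand (rtA p) * |(rtAL p).det|
  rw [abs_det_rtAL (show p ∈ rtDom from hp), pullA_integrand]

/-- rule (2) along chart B: `[Ψ_A^* r] ≡ [r']` as soon as `r = ρ^* r'` on `Δ₄`. -/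
theorem pullA_rel' (r r' : KZ.IntegralRep 4) (hr : r.domain = KZ.openOrderedSimplex 4)
    (hr' : r'.domain = KZ.openOrderedSimplex 4)
    (h : ∀ t ∈ KZ.openOrderedSimplex 4,
      r.integrand t = r'.integrand (rot4 t) * (t 3 ^ 3 / (t 0 * t 1 * t 2) ^ 2)) :
    KZ.of (pullA r hr) - KZ.of r' ∈ KZ.relations := by
  have hΦsa : IsSemialgebraicMapOn ℚ (pullA r hr).domain rtB := isSemialgebraicMapOn_rtB
  have hder : ∀ x ∈ (pullA r hr).domain, HasFDerivWithinAt rtB (rtBL x) (pullA r hr).domain x :=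
    fun x _ => (hasFDerivAt_rtB x).hasFDerivWithinAt
  have hinj : InjOn rtB (pullA r hr).domain := injOn_rtB
  have hdom : r'.domain = rtB '' (pullA r hr).domain := by rw [pullA_domain, image_rtB, hr']
  refine KZ.changeOfVariablesRel_subset_relations ⟨4, pullA r hr, r', rtB, rtBL, hΦsa, hder, hinj, hdom,
    fun p hp => ?_, rfl⟩
  have hp' : p ∈ rtDom := hp
  obtain ⟨ha, hb, hc, hd, ha', hb', hc', hd'⟩ := rtDom_facts hp'
  show (pullA r hr).integrand p = r'.integrand (rtB p) * |(rtBL p).det|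
  rw [abs_det_rtBL hp', pullA_integrand, h _ (rtA_mem hp'), rot4_rtA hp', rtA_zero, rtA_one, rtA_two,
    rtA_three]
  field_simp

/-- **THE ROTATION MOVE, PROVED.**  If `r, r'` are representations on `Δ₄` with `r = ρ^* r'`
(`r.integrand t = r'.integrand (ρ t) · |det Dρ(t)|`, `|det Dρ(t)| = t₃³/(t₀t₁t₂)²`), then
`[r] ≡ [r']` modulo `KZ.relations` — two applications of rule (2) along the polynomial charts
`Ψ_A, Ψ_B : P → Δ₄`.  [Kontsevich–Zagier 2001 §1.2 rule (2); Brown–Carr–Schneps arXiv:0910.0122 §2.2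
(dihedral symmetry of cell-zeta values)] -/
theorem rot_rel (r r' : KZ.IntegralRep 4) (hr : r.domain = KZ.openOrderedSimplex 4)
    (hr' : r'.domain = KZ.openOrderedSimplex 4)
    (h : ∀ t ∈ KZ.openOrderedSimplex 4,
      r.integrand t = r'.integrand (rot4 t) * (t 3 ^ 3 / (t 0 * t 1 * t 2) ^ 2)) :
    KZ.of r - KZ.of r' ∈ KZ.relations := by
  have h₁ := pullA_rel r hr
  have h₂ := pullA_rel' r r' hr hr' h
  have : KZ.of r - KZ.of r' = (KZ.of (pullA r hr) - KZ.of r') - (KZ.of (pullA r hr) - KZ.of r) := by abel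
  rw [this]
  exact KZ.relations.sub_mem h₂ h₁

/-! ## 8  The reflection of `D₇` (duality) `δ(t) = (1-t₃, 1-t₂, 1-t₁, 1-t₀)` as a move

Together with `ρ` this gives the whole dihedral group `D₇ = ⟨ρ, δ⟩` of `M_{0,7}` acting on
representations over `Δ₄` by PROVED relations of the KZ calculus (BCS §2.2 "dihedral symmetry"). -/

/-- the reflection / duality `δ(t) = (1 - t₃, 1 - t₂, 1 - t₁, 1 - t₀)`. -/
def refl4 (t : Fin 4 → ℝ) : Fin 4 → ℝ := ![1 - t 3, 1 - t 2, 1 - t 1, 1 - t 0]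

/-- Auxiliary step `refl4_zero`: refl4 zero. [bookkeeping] -/
theorem refl4_zero (t : Fin 4 → ℝ) : refl4 t 0 = 1 - t 3 := rfl
/-- Auxiliary step `refl4_one`: refl4 one. [bookkeeping] -/
theorem refl4_one (t : Fin 4 → ℝ) : refl4 t 1 = 1 - t 2 := rfl
/-- Auxiliary step `refl4_two`: refl4 two. [bookkeeping] -/
theorem refl4_two (t : Fin 4 → ℝ) : refl4 t 2 = 1 - t 1 := rfl
/-- Auxiliary step `refl4_three`: refl4 three. [bookkeeping] -/
theorem refl4_three (t : Fin 4 → ℝ) : refl4 t 3 = 1 - t 0 := rfl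

/-- Auxiliary step `refl4_refl4`: refl4 refl4. [bookkeeping] -/
theorem refl4_refl4 (t : Fin 4 → ℝ) : refl4 (refl4 t) = t := by
  funext i
  fin_cases i <;> simp [refl4_zero, refl4_one, refl4_two, refl4_three]

/-- Auxiliary step `refl4_mem`: refl4 mem. [bookkeeping] -/
theorem refl4_mem {t : Fin 4 → ℝ} (ht : t ∈ KZ.openOrderedSimplex 4) : refl4 t ∈ KZ.openOrderedSimplex 4 := by
  obtain ⟨h3, h32, h21, h10, h0⟩ := (mem_simplex_four_iff t).1 ht
  rw [mem_simplex_four_iff, refl4_zero, refl4_one, refl4_two, refl4_three]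
  exact ⟨by linarith, by linarith, by linarith, by linarith, by linarith⟩

/-- Auxiliary step `image_refl4`: image refl4. [bookkeeping] -/
theorem image_refl4 : refl4 '' KZ.openOrderedSimplex 4 = KZ.openOrderedSimplex 4 := by
  ext u
  constructor
  · rintro ⟨t, ht, rfl⟩
    exact refl4_mem ht
  · intro hu
    exact ⟨refl4 u, refl4_mem hu, refl4_refl4 u⟩

/-- Auxiliary step `injOn_refl4`: inj On refl4. [bookkeeping] -/
theorem injOn_refl4 (A : Set (Fin 4 → ℝ)) : InjOn refl4 A := fun a _ b _ hab => by
  have := congrArg refl4 hab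
  rwa [refl4_refl4, refl4_refl4] at this

/-- `Dδ` (constant). -/
def reflL : (Fin 4 → ℝ) →L[ℝ] (Fin 4 → ℝ) := ContinuousLinearMap.pi ![-Pj 3, -Pj 2, -Pj 1, -Pj 0]

/-- Auxiliary step `reflL_apply`: refl L apply. [bookkeeping] -/
theorem reflL_apply (h : Fin 4 → ℝ) : reflL h = ![-h 3, -h 2, -h 1, -h 0] := by
  funext i
  fin_cases i <;> simp [reflL]

/-- Auxiliary step `reflL_reflL`: refl L refl L. [bookkeeping] -/
theorem reflL_reflL (h : Fin 4 → ℝ) : reflL (reflL h) = h := by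
  rw [reflL_apply, reflL_apply]
  funext i
  fin_cases i <;> simp

/-- Auxiliary step `hasFDerivAt_refl4`: has FDeriv At refl4. [bookkeeping] -/
theorem hasFDerivAt_refl4 (t : Fin 4 → ℝ) : HasFDerivAt refl4 reflL t := by
  have key : HasFDerivAt (fun q : Fin 4 → ℝ => fun i => (![1 - q 3, 1 - q 2, 1 - q 1, 1 - q 0] :
      Fin 4 → ℝ) i) (ContinuousLinearMap.pi ![-Pj 3, -Pj 2, -Pj 1, -Pj 0]) t := by
    refine hasFDerivAt_pi.2 fun i => ?_
    fin_cases i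
    · simpa using (hasFDerivAt_coord 3 t).const_sub 1
    · simpa using (hasFDerivAt_coord 2 t).const_sub 1
    · simpa using (hasFDerivAt_coord 1 t).const_sub 1
    · simpa using (hasFDerivAt_coord 0 t).const_sub 1
  exact key

/-- `|det L| = 1` for a linear involution of `ℝ⁴`. -/
theorem abs_det_of_invol4 {L : (Fin 4 → ℝ) →L[ℝ] (Fin 4 → ℝ)} (h : ∀ w, L (L w) = w) : |L.det| = 1 := by
  have hcomp : (L : (Fin 4 → ℝ) →ₗ[ℝ] (Fin 4 → ℝ)) ∘ₗ (L : (Fin 4 → ℝ) →ₗ[ℝ] (Fin 4 → ℝ)) = LinearMap.id := by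
    apply LinearMap.ext
    intro w
    simp [h]
  have h1 := congrArg LinearMap.det hcomp
  rw [LinearMap.det_comp, LinearMap.det_id] at h1
  have h2 : |LinearMap.det (L : (Fin 4 → ℝ) →ₗ[ℝ] (Fin 4 → ℝ))| ^ 2 = 1 := by
    rw [sq_abs, sq, h1]
  exact (pow_eq_one_iff_of_nonneg (abs_nonneg _) two_ne_zero).1 h2

/-- Auxiliary step `abs_det_reflL`: abs det refl L. [bookkeeping] -/
theorem abs_det_reflL : |reflL.det| = 1 := abs_det_of_invol4 reflL_reflL

/-- Auxiliary step `isSemialgebraicMapOn_refl4`: is Semialgebraic Map On refl4. [bookkeeping] -/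
theorem isSemialgebraicMapOn_refl4 {A : Set (Fin 4 → ℝ)} (hA : IsSemialgebraic ℚ A) :
    IsSemialgebraicMapOn ℚ A refl4 :=
  (isSemialgebraicMapOn_aeval hA
    ![C 1 - X 3, C 1 - X 2, C 1 - X 1, (C 1 - X 0 : MvPolynomial (Fin 4) ℚ)]).congr
    fun p _ => by
      funext j
      fin_cases j <;> simp [refl4_zero, refl4_one, refl4_two, refl4_three]

/-- **THE REFLECTION MOVE, PROVED** (rule (2), affine chart, `|det| = 1`): if `r, r'` live on `Δ₄` and
`r.integrand = r'.integrand ∘ δ` on `Δ₄`, then `[r] ≡ [r']`.  [Kontsevich–Zagier 2001 §1.2 rule (2)] -/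
theorem refl_rel (r r' : KZ.IntegralRep 4) (hr : r.domain = KZ.openOrderedSimplex 4)
    (hr' : r'.domain = KZ.openOrderedSimplex 4)
    (h : ∀ t ∈ KZ.openOrderedSimplex 4, r.integrand t = r'.integrand (refl4 t)) :
    KZ.of r - KZ.of r' ∈ KZ.relations := by
  have hΦsa : IsSemialgebraicMapOn ℚ r.domain refl4 := by
    rw [hr]; exact isSemialgebraicMapOn_refl4 (KZ.isSemialgebraic_openOrderedSimplex 4)
  have hder : ∀ x ∈ r.domain, HasFDerivWithinAt refl4 reflL r.domain x :=
    fun x _ => (hasFDerivAt_refl4 x).hasFDerivWithinAt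
  have hinj : InjOn refl4 r.domain := injOn_refl4 _
  have hdom : r'.domain = refl4 '' r.domain := by rw [hr, image_refl4, hr']
  refine KZ.changeOfVariablesRel_subset_relations ⟨4, r, r', refl4, fun _ => reflL, hΦsa, hder, hinj, hdom,
    fun t ht => ?_, rfl⟩
  show r.integrand t = r'.integrand (refl4 t) * |reflL.det|
  rw [abs_det_reflL, mul_one]
  exact h t (by rw [← hr]; exact ht)

end Summit.KontsevichZagierPeriods.KontsevichZagierPeriods.Cruxes.GZNormalFormWThree.GZLadder.RotFour

namespace Summit.KontsevichZagierPeriods.KontsevichZagierPeriods.Cruxes.GZNormalFormWThree.GZLadder.Shuffle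

open Set MeasureTheory
open Literature.NumberTheory.Transcendental
open Literature.ModelTheory.ExponentialFields

variable {n a b k : ℕ}

/-! ## 1  Sorting permutations and the shuffle cells of the MZV simplex -/

/-- Auxiliary step `comp_mem_simplex_iff`: comp mem simplex iff. [bookkeeping] -/
theorem comp_mem_simplex_iff (e : Fin n ≃ Fin n) {z : Fin n → ℝ} :
    (fun k => z (e k)) ∈ KZ.openOrderedSimplex n ↔
      (∀ m, 0 < z m ∧ z m < 1) ∧ (List.ofFn e).Pairwise (fun m m' => z m' < z m) := by
  rw [List.pairwise_ofFn]
  constructor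
  · rintro ⟨h0, h1, ha⟩
    exact ⟨fun m => ⟨by simpa using h0 (e.symm m), by simpa using h1 (e.symm m)⟩, fun i j hij => ha hij⟩
  · rintro ⟨h01, h2⟩
    exact ⟨fun k => (h01 _).1, fun k => (h01 _).2, fun i j hij => h2 hij⟩

/-- distinct sorting permutations have disjoint cells -/
theorem ofFn_eq_of_comp_mem_simplex {e₁ e₂ : Fin n ≃ Fin n} {z : Fin n → ℝ}
    (h₁ : (fun k => z (e₁ k)) ∈ KZ.openOrderedSimplex n) (h₂ : (fun k => z (e₂ k)) ∈ KZ.openOrderedSimplex n) :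
    List.ofFn e₁ = List.ofFn e₂ :=
  List.Perm.eq_of_pairwise (le := fun m m' => z m' < z m)
    (fun _ _ _ _ h h' => absurd h' (lt_asymm h)) ((comp_mem_simplex_iff e₁).1 h₁).2
    ((comp_mem_simplex_iff e₂).1 h₂).2 ((KZ.ofFn_perm_finRange e₁).trans (KZ.ofFn_perm_finRange e₂).symm)

/-- `e` is a coordinate shuffle of the blocks `Fin a`, `Fin b` of `Fin (a + b)` -/
abbrev IsShuffle (a b : ℕ) (e : Fin (a + b) ≃ Fin (a + b)) : Prop :=
  List.ofFn e ∈ MZV.shuffleWord (List.ofFn (Fin.castAdd b : Fin a → Fin (a + b))) (List.ofFn (Fin.natAdd a))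

/-- cells lie in the product of simplices -/
theorem mem_simplex_of_comp_mem_simplex {e : Fin (a + b) ≃ Fin (a + b)} (he : IsShuffle a b e)
    {z : Fin (a + b) → ℝ} (hz : (fun k => z (e k)) ∈ KZ.openOrderedSimplex (a + b)) :
    (fun i => z (Fin.castAdd b i)) ∈ KZ.openOrderedSimplex a ∧
      (fun j => z (Fin.natAdd a j)) ∈ KZ.openOrderedSimplex b := by
  rw [comp_mem_simplex_iff] at hz
  obtain ⟨hb, hs⟩ := hz
  obtain ⟨hl, hr⟩ := MZV.sublist_of_mem_shuffleWord _ _ he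
  have hl' := List.pairwise_ofFn.1 (hs.sublist hl)
  have hr' := List.pairwise_ofFn.1 (hs.sublist hr)
  exact ⟨⟨fun i => (hb _).1, fun i => (hb _).2, fun i j hij => hl' hij⟩,
    ⟨fun j => (hb _).1, fun j => (hb _).2, fun i j hij => hr' hij⟩⟩

/-- the cells cover the product off the walls -/
theorem exists_comp_mem_simplex {z : Fin (a + b) → ℝ}
    (hx : (fun i => z (Fin.castAdd b i)) ∈ KZ.openOrderedSimplex a)
    (hy : (fun j => z (Fin.natAdd a j)) ∈ KZ.openOrderedSimplex b)
    (hne : ∀ i j, z (Fin.castAdd b i) ≠ z (Fin.natAdd a j)) :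
    ∃ e : Fin (a + b) ≃ Fin (a + b), IsShuffle a b e ∧ (fun k => z (e k)) ∈ KZ.openOrderedSimplex (a + b) := by
  obtain ⟨hx0, hx1, hxa⟩ := hx
  obtain ⟨hy0, hy1, hya⟩ := hy
  obtain ⟨w, hw, hs⟩ := MZV.exists_pairwise_mem_shuffleWord
    (R := fun m m' : Fin (a + b) => z m' < z m) (fun _ _ _ h h' => h'.trans h)
    (List.ofFn (Fin.castAdd b : Fin a → Fin (a + b)))
    (List.ofFn (Fin.natAdd a : Fin b → Fin (a + b)))
    (List.pairwise_ofFn.2 fun i j hij => hxa hij)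
    (List.pairwise_ofFn.2 fun i j hij => hya hij)
    (fun m hm m' hm' => by
      obtain ⟨i, rfl⟩ := List.mem_ofFn.1 hm
      obtain ⟨j, rfl⟩ := List.mem_ofFn.1 hm'
      exact (lt_or_gt_of_ne (hne i j)).symm)
  obtain ⟨e, rfl⟩ := KZ.exists_equiv_of_perm_finRange
    (KZ.ofFn_castAdd_append_ofFn_natAdd a b ▸ MZV.perm_of_mem_shuffleWord _ _ hw)
  refine ⟨e, hw, (comp_mem_simplex_iff e).2 ⟨fun m => ?_, hs⟩⟩
  refine Fin.addCases (motive := fun m => 0 < z m ∧ z m < 1) (fun i => ⟨hx0 i, hx1 i⟩) (fun j => ⟨hy0 j, hy1 j⟩) m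

/-! ## 2  The dissection of `Δ_a × Δ_b` into shuffle cells (rules (1a), (2)) -/

end Summit.KontsevichZagierPeriods.KontsevichZagierPeriods.Cruxes.GZNormalFormWThree.GZLadder.Shuffle
end
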